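import Summits.ResolutionOfSingularities.ResolutionOfSingularities.Theorems.WeightedInvariantDatumToEmbeddedCentreHomogeneousCoaction
import Summits.ResolutionOfSingularities.ResolutionOfSingularities.Theorems.WeightedInvariantLexMaxCentreTransport
import Summits.ResolutionOfSingularities.ResolutionOfSingularities.Theorems.WeightedInvariantHypersurfaceCentreAlgebraize
import Summits.ResolutionOfSingularities.ResolutionOfSingularities.Theorems.WeightedInvariantWeightedConstructionWeightedChartBasicOpen
import HarnessLib

/-!
# (hom) for all chart gradings of the orbit centre — the algebraic kernel: homogeneity of a primary
# contraction from the comparison of its two pull-backs at the generic torus point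

Route `ResolutionOfSingularities/WeightedInvariant`, door crux `HypersurfaceCentreConstruction`
(stmt-ResolutionOfSingularities-19897) — OURS, helper; e-ladder rung `e = 1`, registered stub `stub_e1_centre`
of `res-L1-w43-stub-10` (cell res-hironaka, `D/res-D-pv-025/DOOR-ELADDER-PLAN.md` §7 item **(L3)** «(hom) for
every grading of every affine `W`»; taken by res-type-047, OFFER 2026-08-27T07:48Z).  This file is the
FACT-FREE commutative-algebra kernel of (L3); the Abramovich–Quek–Schober input (the lex-maximal centre after the
separable base change `k(t₁, …, t_m)/k`) enters only the hypothesis `hB` of the last theorem and is discharged in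
the companion file.

SETTING.  `A` a commutative ring graded by an abelian group `M` with unique sums (`ℤʲ`): coaction
`ρ : A → A[M]`, inclusion `ι₀ = singleZeroRingHom` (`…CentreHomogeneousCoaction`); `P` a prime of `A` (the orbit
closure `closure {η} ∩ W`), `O = A_P` (any localization at `P`: in the application the stalk `𝒪_{Y,η}`),
`𝔓 = P · A[M]` (the generic point `ζ` of `𝔾(M) × V(P)`; prime), `B = A[M]_𝔓` (any localization: in the application a
stalk of `Spec (A ⊗_k k(t))`), and `ε_P, ρ_P : O → B` the local maps induced by `ι₀` and `ρ` (`pr_ζ^#`, `act_ζ^#`).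

* §1 `eq_zero_of_mul_eq_zero_of_coeff_not_mem` — over a ring `C` whose non-units form a nilpotent ideal `𝔫`
  (an Artinian local ring), an element of `C[M]` with one coefficient outside `𝔫` is a non-zero-divisor
  (unique sums for the unit part, nilpotence for the rest);
* §2 `mem_map_comap_of_mul_mem` — SATURATION: for `I ⊆ O` containing a power of `P · O` and `𝔞 = A ∩ I`,
  `s ∉ 𝔓 ∧ s z ∈ 𝔞 · A[M] ⇒ z ∈ 𝔞 · A[M]` (read in `(O ⧸ I)[M]`, §1) — the pull-back `pr⁻¹(A ∩ I)` is primary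
  along `T × V(P)`;
* §3 `isHomogeneous_comap_of_map_le` — KERNEL: `ρ_P(I) · B ≤ ε_P(I) · B ⇒ A ∩ I` is HOMOGENEOUS
  (`isHomogeneous_of_map_coaction_le` after clearing the denominator by §2);
* §4 `exists_ringEquiv_comp_eq` — the TWIST: for `P` homogeneous the shear `θ` (`ι₀ ≫ θ = ρ`,
  `exists_ringEquiv_comp_eq_coaction`) fixes `𝔓` and descends to `θ_B : B ≃ B` with `θ_B ∘ ε_P = ρ_P`, fixing
  `F · B` for every homogeneous `F ⊆ A`; `isHomogeneous_comap_weightedMonomialIdeal` — **(L3) at ring level**: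
  if `(ε_P ∘ x; w; ℓ)` is the lex-maximal admissible weighted centre germ (`IsLexMaxWeightedCentreGerm`,
  Abramovich–Quek–Schober 2025 Thm 3.5 [cite: AbramovichQuekSchober2025]) of `F · B` for a homogeneous `F` and
  generators `x` of `P · O`, then every contracted piece `A ∩ (x^α : w·α ≥ n)` is homogeneous — UNIQUENESS
  (`LexMaxCentre.weightedMonomialIdeal_map_eq_of_ringEquiv`, res-D-pv-023) applied to `θ_B` gives
  `ρ_P(I_n) B = ε_P(I_n) B`, then §3.  This is Abramovich–Quek–Schober §5 (i) ("by the uniqueness of `J`,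
  `t · J = J`") with the generic torus point in place of `T(k^sep)`-density, so FINITE `k` is covered.

Pure commutative algebra over Mathlib and the tree's coaction file; no schemes, no facts, no definitions.  Nothing
here is a claim about Hironaka's problem or about any manuscript under adjudication; AI-written, weaker than expert
review.
-/

noncomputable section

set_option linter.dupNamespace false -- mandated namespace of this single-conjunct summit

namespace Summit.ResolutionOfSingularities.ResolutionOfSingularities.Theorems.OrbitCentreHomogeneous

open AddMonoidAlgebra DatumToEmbedded.CentreHomogeneous IsLocalRing
open Literature.AlgebraicGeometry.Resolution

/-! ## §1 Non-zero-divisors of `C[M]` over a ring with a nilpotent ideal of non-units -/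

section NZD

variable {M C : Type*} [AddCommGroup M] [CommRing C]

/-- An element of `C[M]` all of whose non-zero coefficients are units, and which has one, is a
non-zero-divisor (`M` with unique sums, e.g. `ℤʲ`): the uniquely reached coefficient of a product is a
unit times a non-zero coefficient. [folklore] -/
theorem eq_zero_of_mul_eq_zero_of_forall_isUnit [UniqueSums M] {s : C[M]}
    (hs : ∀ m ∈ s.coeff.support, IsUnit (s.coeff m)) (hne : s ≠ 0) {g : C[M]} (h : s * g = 0) :
    g = 0 := by
  by_contra hg
  have hs' : s.coeff.support.Nonempty := by
    rw [Finsupp.support_nonempty_iff]; exact fun h0 => hne (by ext m; simp [h0])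
  have hg' : g.coeff.support.Nonempty := by
    rw [Finsupp.support_nonempty_iff]; exact fun h0 => hg (by ext m; simp [h0])
  obtain ⟨a0, ha0, b0, hb0, hu⟩ := UniqueSums.uniqueAdd_of_nonempty hs' hg'
  have hc := coeff_mul_add_of_uniqueAdd (f := s) (g := g) hu
  rw [h] at hc
  simp only [coeff_zero, Finsupp.coe_zero, Pi.zero_apply] at hc
  exact (Finsupp.mem_support_iff.mp hb0) ((hs a0 ha0).mul_right_eq_zero.mp hc.symm)

/-- Powers of such an element are non-zero-divisors too. [folklore] -/
theorem eq_zero_of_pow_mul_eq_zero_of_forall_isUnit [UniqueSums M] {s : C[M]}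
    (hs : ∀ m ∈ s.coeff.support, IsUnit (s.coeff m)) (hne : s ≠ 0) (n : ℕ) {g : C[M]}
    (h : s ^ n * g = 0) : g = 0 := by
  induction n generalizing g with
  | zero => simpa using h
  | succ n ih =>
    rw [pow_succ, mul_assoc] at h
    exact eq_zero_of_mul_eq_zero_of_forall_isUnit hs hne (ih h)

/-- **Unit coefficient ⇒ non-zero-divisor, over a ring whose non-units form a nilpotent ideal.**  Let
`𝔫 ≤ C` be an ideal with `𝔫 ^ N = 0` off which every element is a unit (e.g. the maximal ideal of an
Artinian local ring).  An element `s ∈ C[M]` with SOME coefficient outside `𝔫` is a non-zero-divisor of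
`C[M]`: `s = s₁ + s₀` with `s₁` (the coefficients outside `𝔫`) a non-zero-divisor by unique sums and `s₀`
(the coefficients in `𝔫`) nilpotent. [folklore] -/
theorem eq_zero_of_mul_eq_zero_of_coeff_not_mem [UniqueSums M] (𝔫 : Ideal C)
    (hunit : ∀ c, c ∉ 𝔫 → IsUnit c) {N : ℕ} (hnil : 𝔫 ^ N = ⊥) {s : C[M]} {m₀ : M}
    (hm₀ : s.coeff m₀ ∉ 𝔫) {g : C[M]} (h : s * g = 0) : g = 0 := by
  classical
  -- split `s` into its coefficients outside / inside `𝔫`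
  set s₁ : C[M] := ofCoeff (s.coeff.filter fun m => s.coeff m ∉ 𝔫) with hs₁
  set s₀ : C[M] := ofCoeff (s.coeff.filter fun m => ¬ (s.coeff m ∉ 𝔫)) with hs₀
  have hsum : s₁ + s₀ = s := by
    rw [hs₁, hs₀, ← ofCoeff_add, Finsupp.filter_add_filter_not]
  have hc₁ : ∀ m, s₁.coeff m = if s.coeff m ∉ 𝔫 then s.coeff m else 0 := fun m => by
    rw [hs₁, coeff_ofCoeff, Finsupp.filter_apply]
  have hc₀ : ∀ m, s₀.coeff m = if ¬ (s.coeff m ∉ 𝔫) then s.coeff m else 0 := fun m => by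
    rw [hs₀, coeff_ofCoeff, Finsupp.filter_apply]
  have h₁unit : ∀ m ∈ s₁.coeff.support, IsUnit (s₁.coeff m) := by
    intro m hm
    rw [Finsupp.mem_support_iff, hc₁] at hm
    rw [hc₁]
    by_cases hp : s.coeff m ∉ 𝔫
    · rw [if_pos hp]; exact hunit _ hp
    · rw [if_neg hp] at hm; exact (hm rfl).elim
  have h₁ne : s₁ ≠ 0 := by
    intro h0
    have := congrArg (fun x : C[M] => x.coeff m₀) h0
    simp only [hc₁, if_pos hm₀, coeff_zero, Finsupp.coe_zero, Pi.zero_apply] at this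
    exact hm₀ (this ▸ 𝔫.zero_mem)
  have h₀mem : s₀ ∈ 𝔫.map (singleZeroRingHom : C →+* C[M]) := by
    refine mem_map_of_coeff_mem fun m => ?_
    rw [hc₀]
    by_cases hp : ¬ (s.coeff m ∉ 𝔫)
    · rw [if_pos hp]; exact not_not.mp hp
    · rw [if_neg hp]; exact 𝔫.zero_mem
  have h₀nil : s₀ ^ N = 0 := by
    have hmem : s₀ ^ N ∈ (𝔫.map (singleZeroRingHom : C →+* C[M])) ^ N := Ideal.pow_mem_pow h₀mem N
    rw [← Ideal.map_pow, hnil, Ideal.map_bot] at hmem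
    exact hmem
  -- `s₁ g = -s₀ g`, hence `s₁ⁿ g = (-s₀)ⁿ g = 0` for `n = N`
  have hsg : s₁ * g = -s₀ * g := by
    rw [← hsum, add_mul] at h
    rw [neg_mul]
    exact eq_neg_of_add_eq_zero_left h
  have hpow : ∀ n : ℕ, s₁ ^ n * g = (-s₀) ^ n * g := by
    intro n
    induction n with
    | zero => simp
    | succ n ih => rw [pow_succ, mul_assoc, hsg, ← mul_assoc, mul_comm (s₁ ^ n) (-s₀), mul_assoc, ih,
        ← mul_assoc, ← pow_succ']
  have hN : s₁ ^ N * g = 0 := by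
    rw [hpow N, neg_pow, mul_assoc, h₀nil, zero_mul, mul_zero]
  exact eq_zero_of_pow_mul_eq_zero_of_forall_isUnit h₁unit h₁ne N hN

end NZD

/-! ## §2 Saturation: `𝔞 · A[M]` is contracted from the generic torus point when `𝔞` is contracted from an
`𝔪`-primary ideal of `A_P` -/

section Saturation

variable {M A : Type*} [AddCommGroup M] [CommRing A]
  (P : Ideal A) [P.IsPrime] (O : Type*) [CommRing O] [Algebra A O] [IsLocalization.AtPrime O P]
  (I : Ideal O)

/-- Membership in the extension `𝔞 · A[M]` of the contraction `𝔞 = A ∩ I` of an ideal `I ⊆ A_P`: all coefficients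
contract into `I`. [folklore] -/
theorem mem_map_singleZeroRingHom_comap_iff (z : A[M]) :
    z ∈ (I.comap (algebraMap A O)).map (singleZeroRingHom : A →+* A[M]) ↔
      ∀ m, algebraMap A O (z.coeff m) ∈ I := by
  classical
  exact ⟨fun hz m => Ideal.mem_comap.mp (coeff_mem_of_mem_map hz m),
    fun h => mem_map_of_coeff_mem fun m => Ideal.mem_comap.mpr (h m)⟩

/-- **Saturation.**  Let `I ⊆ A_P` contain a power of the maximal ideal `P · A_P` and let `𝔞 = A ∩ I` be its
contraction (a `P`-primary ideal).  If `s ∈ A[M]` has a coefficient outside `P` (i.e. `s ∉ P · A[M]`, the prime of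
the generic point of the torus over `V(P)`) and `s · z ∈ 𝔞 · A[M]`, then `z ∈ 𝔞 · A[M]`: reduce to `(A_P ⧸ I)[M]`,
where `s` has a unit coefficient and the non-units form a nilpotent ideal (§1). [folklore] -/
theorem mem_map_comap_of_mul_mem [UniqueSums M] (hN : ∃ N : ℕ, (P.map (algebraMap A O)) ^ N ≤ I)
    {s z : A[M]} {m₀ : M} (hs : s.coeff m₀ ∉ P)
    (h : s * z ∈ (I.comap (algebraMap A O)).map (singleZeroRingHom : A →+* A[M])) :
    z ∈ (I.comap (algebraMap A O)).map (singleZeroRingHom : A →+* A[M]) := by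
  classical
  by_cases hI : I = ⊤
  · subst hI; rw [Ideal.comap_top, Ideal.map_top]; exact Submodule.mem_top
  haveI : IsLocalRing O := IsLocalization.AtPrime.isLocalRing O P
  have hmax : P.map (algebraMap A O) = maximalIdeal O := by
    rw [← IsLocalization.AtPrime.under_maximalIdeal O P, Ideal.under_def,
      IsLocalization.map_under P.primeCompl (S := O)]
  obtain ⟨N, hN⟩ := hN
  -- the reduction map `A[M] → (A_P ⧸ I)[M]` and its kernel
  let φ : A[M] →+* (O ⧸ I)[M] :=
    (mapRingHom M (Ideal.Quotient.mk I)).comp (mapRingHom M (algebraMap A O))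
  have hφ : ∀ y : A[M], φ y = 0 ↔
      y ∈ (I.comap (algebraMap A O)).map (singleZeroRingHom : A →+* A[M]) := by
    intro y
    rw [mem_map_singleZeroRingHom_comap_iff, AddMonoidAlgebra.ext_iff, Finsupp.ext_iff]
    refine forall_congr' fun m => ?_
    simp only [φ, RingHom.coe_comp, Function.comp_apply, coeff_mapRingHom, coeff_zero,
      Finsupp.coe_zero, Pi.zero_apply, Ideal.Quotient.eq_zero_iff_mem]
  -- the nilpotent ideal of non-units of `A_P ⧸ I`
  let 𝔫 : Ideal (O ⧸ I) := (maximalIdeal O).map (Ideal.Quotient.mk I)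
  have hunit : ∀ c, c ∉ 𝔫 → IsUnit c := by
    intro c hc
    obtain ⟨o, rfl⟩ := Ideal.Quotient.mk_surjective c
    have ho : o ∉ maximalIdeal O := fun ho => hc (Ideal.mem_map_of_mem _ ho)
    exact (IsLocalRing.notMem_maximalIdeal.mp ho).map _
  have hnil : 𝔫 ^ N = ⊥ := by
    rw [← Ideal.map_pow, ← hmax, eq_bot_iff, ← Ideal.map_quotient_self I]
    exact Ideal.map_mono hN
  have hm₀ : (φ s).coeff m₀ ∉ 𝔫 := by
    simp only [φ, RingHom.coe_comp, Function.comp_apply, coeff_mapRingHom]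
    intro hmem
    rw [Ideal.mem_map_iff_of_surjective _ Ideal.Quotient.mk_surjective] at hmem
    obtain ⟨o, ho, hoe⟩ := hmem
    rw [Ideal.Quotient.eq] at hoe
    have hI' : I ≤ maximalIdeal O := IsLocalRing.le_maximalIdeal hI
    have : algebraMap A O (s.coeff m₀) ∈ maximalIdeal O := by
      have h1 := hI' hoe
      have h2 : algebraMap A O (s.coeff m₀) = o - (o - algebraMap A O (s.coeff m₀)) := by ring
      rw [h2]; exact Ideal.sub_mem _ ho h1
    exact hs ((IsLocalization.AtPrime.to_map_mem_maximal_iff O P _).mp this)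
  have hprod : φ s * φ z = 0 := by rw [← map_mul]; exact (hφ _).mpr h
  exact (hφ z).mp (eq_zero_of_mul_eq_zero_of_coeff_not_mem 𝔫 hunit hnil hm₀ hprod)

end Saturation

/-! ## §3 The kernel: homogeneity of the contraction from the comparison of the two pull-backs at the
generic torus point -/

section Kernel

variable {M A σ : Type*} [DecidableEq M] [AddCommGroup M] [CommRing A] [SetLike σ A]
  [AddSubgroupClass σ A] (𝒜 : M → σ) [GradedRing 𝒜]
  (ρ : A →+* A[M]) (hρ : ∀ (i : M) (a : A), a ∈ 𝒜 i → ρ a = single i a)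
  (P : Ideal A) [P.IsPrime] (O : Type*) [CommRing O] [Algebra A O] [IsLocalization.AtPrime O P]
  (𝔓 : Ideal A[M]) [𝔓.IsPrime] (h𝔓 : 𝔓 = P.map (singleZeroRingHom : A →+* A[M]))
  (B : Type*) [CommRing B] [Algebra A[M] B] [IsLocalization.AtPrime B 𝔓]
  (εP ρP : O →+* B) (hε : εP.comp (algebraMap A O) = (algebraMap A[M] B).comp singleZeroRingHom)
  (hρP : ρP.comp (algebraMap A O) = (algebraMap A[M] B).comp ρ)
include hρ h𝔓 hε hρP

/-- **Kernel.**  `A` graded by `M` with coaction `ρ` and inclusion `ι₀ : A → A[M]`; `P` a prime of `A`, `O = A_P`,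
`𝔓 = P · A[M]` (the generic point of the torus `𝔾(M) × V(P)`), `B = A[M]_𝔓`, and `ε_P, ρ_P : O → B` the maps induced
by `ι₀` and `ρ` (both send `A ∖ P` to units).  If an ideal `I ⊆ O` containing a power of `P · O` satisfies
`ρ_P(I) · B ⊆ ε_P(I) · B`, then its contraction `A ∩ I` is HOMOGENEOUS: for `z ∈ ρ(A ∩ I) · A[M]` one gets
`z/1 ∈ (A ∩ I) · B`, i.e. `s z ∈ (A ∩ I) · A[M]` for some `s ∉ 𝔓`, and the saturation §2 removes `s`. [folklore] -/
theorem isHomogeneous_comap_of_map_le [UniqueSums M] (I : Ideal O)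
    (hN : ∃ N : ℕ, (P.map (algebraMap A O)) ^ N ≤ I) (hle : I.map ρP ≤ I.map εP) :
    (I.comap (algebraMap A O)).IsHomogeneous 𝒜 := by
  refine isHomogeneous_of_map_coaction_le 𝒜 ρ hρ fun z hz => ?_
  set 𝔞 := I.comap (algebraMap A O) with h𝔞
  have h𝔞I : 𝔞.map (algebraMap A O) = I := by
    rw [h𝔞, ← Ideal.under_def, IsLocalization.map_under P.primeCompl (S := O)]
  -- `z / 1 ∈ (𝔞 · A[M]) · B`
  have h1 : algebraMap A[M] B z ∈ (𝔞.map (singleZeroRingHom : A →+* A[M])).map (algebraMap A[M] B) := by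
    have hz' : algebraMap A[M] B z ∈ (𝔞.map ρ).map (algebraMap A[M] B) := Ideal.mem_map_of_mem _ hz
    rw [Ideal.map_map, ← hρP, ← Ideal.map_map] at hz'
    rw [Ideal.map_map, ← hε, ← Ideal.map_map, h𝔞I]
    exact hle (Ideal.map_mono (h𝔞I ▸ le_rfl) hz')
  obtain ⟨s, hs, hsz⟩ := (IsLocalization.algebraMap_mem_map_algebraMap_iff 𝔓.primeCompl B _ z).mp h1
  -- `s ∉ P · A[M]` has a coefficient outside `P`
  have hcoeff : ∃ m₀, s.coeff m₀ ∉ P := by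
    by_contra hall
    push Not at hall
    exact hs (h𝔓 ▸ mem_map_of_coeff_mem hall)
  obtain ⟨m₀, hm₀⟩ := hcoeff
  exact mem_map_comap_of_mul_mem P O I hN hm₀ hsz

end Kernel

/-! ## §4 The twist: from the lex-maximal centre at the generic torus point to the kernel's hypothesis -/

section Twist

variable {M A σ : Type} [DecidableEq M] [AddCommGroup M] [CommRing A] [SetLike σ A]
  [AddSubgroupClass σ A] (𝒜 : M → σ) [GradedRing 𝒜]
  (ρ : A →+* A[M]) (hρ : ∀ (i : M) (a : A), a ∈ 𝒜 i → ρ a = single i a)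
  (P : Ideal A) [P.IsPrime] (O : Type) [CommRing O] [Algebra A O] [IsLocalization.AtPrime O P]
  (𝔓 : Ideal A[M]) [𝔓.IsPrime] (h𝔓 : 𝔓 = P.map (singleZeroRingHom : A →+* A[M]))
  (B : Type) [CommRing B] [IsLocalRing B] [Algebra A[M] B] [IsLocalization.AtPrime B 𝔓]
  (εP ρP : O →+* B) (hε : εP.comp (algebraMap A O) = (algebraMap A[M] B).comp singleZeroRingHom)
  (hρP : ρP.comp (algebraMap A O) = (algebraMap A[M] B).comp ρ)
include hρ h𝔓 hε hρP

omit [IsLocalRing B] in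
/-- **The twist.**  For a HOMOGENEOUS prime `P`, the shear automorphism `θ : a [m] ↦ ρ(a) [m]` of `A[M]`
(`ι₀ ≫ θ = ρ`) fixes `𝔓 = P · A[M]`, hence induces an automorphism `θ_B` of `B = A[M]_𝔓` with `θ_B ∘ ε_P = ρ_P`
(geometrically: `(t, w) ↦ (t, t · w)` at the generic point of `T × V(P)`), and `θ_B` fixes the extension to `B` of
every homogeneous ideal of `A`. [folklore] -/
theorem exists_ringEquiv_comp_eq (hP : Ideal.IsHomogeneous 𝒜 P) :
    ∃ θB : B ≃+* B, (θB : B →+* B).comp εP = ρP ∧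
      ∀ F : Ideal A, F.IsHomogeneous 𝒜 →
        ((F.map (algebraMap A O)).map εP).map (θB : B →+* B) = (F.map (algebraMap A O)).map εP := by
  obtain ⟨θ, hθ⟩ := exists_ringEquiv_comp_eq_coaction 𝒜 ρ hρ
  replace hθ : (θ : A[M] →+* A[M]).comp singleZeroRingHom = ρ := hθ
  -- `θ` fixes the extension of every homogeneous ideal, in particular `𝔓`
  have hmapθ : ∀ F : Ideal A, F.IsHomogeneous 𝒜 →
      (F.map (singleZeroRingHom : A →+* A[M])).map (θ : A[M] →+* A[M]) = F.map singleZeroRingHom := by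
    intro F hF
    rw [Ideal.map_map, hθ, map_coaction_eq_of_isHomogeneous 𝒜 ρ hρ hF]
  have h𝔓θ : 𝔓.map (θ : A[M] →+* A[M]) = 𝔓 := by rw [h𝔓]; exact hmapθ P hP
  have hmemθ : ∀ y : A[M], θ y ∈ 𝔓 ↔ y ∈ 𝔓 := by
    intro y
    constructor
    · intro hy
      rw [← h𝔓θ, Ideal.map_comap_of_equiv, Ideal.mem_comap] at hy
      simpa using hy
    · intro hy
      rw [← h𝔓θ]
      exact Ideal.mem_map_of_mem _ hy
  have hS : 𝔓.primeCompl.map θ.toMonoidHom = 𝔓.primeCompl := by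
    ext y
    simp only [Submonoid.mem_map, Ideal.mem_primeCompl_iff]
    constructor
    · rintro ⟨x, hx, rfl⟩
      exact fun h => hx ((hmemθ x).mp h)
    · intro hy
      exact ⟨θ.symm y, fun h => hy (by simpa using (hmemθ (θ.symm y)).mpr h), by simp⟩
  let θB : B ≃+* B := IsLocalization.ringEquivOfRingEquiv B B θ hS
  have hθB : ∀ y : A[M], θB (algebraMap A[M] B y) = algebraMap A[M] B (θ y) := fun y =>
    IsLocalization.ringEquivOfRingEquiv_eq hS y
  have hθBalg : (θB : B →+* B).comp (algebraMap A[M] B) = (algebraMap A[M] B).comp (θ : A[M] →+* A[M]) :=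
    RingHom.ext fun y => hθB y
  refine ⟨θB, ?_, ?_⟩
  · apply IsLocalization.ringHom_ext P.primeCompl (S := O)
    rw [RingHom.comp_assoc, hε, ← RingHom.comp_assoc, hθBalg, RingHom.comp_assoc, hθ, hρP]
  · intro F hF
    calc ((F.map (algebraMap A O)).map εP).map (θB : B →+* B)
        = ((F.map (singleZeroRingHom : A →+* A[M])).map (θ : A[M] →+* A[M])).map (algebraMap A[M] B) := by
          simp only [Ideal.map_map]
          congr 1
          rw [hε, ← RingHom.comp_assoc, hθBalg, RingHom.comp_assoc]
      _ = (F.map (singleZeroRingHom : A →+* A[M])).map (algebraMap A[M] B) := by rw [hmapθ F hF]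
      _ = (F.map (algebraMap A O)).map εP := by simp only [Ideal.map_map, hε]

/-- **(L3) at ring level.**  Let `F ⊆ A` be a homogeneous ideal (the hypersurface on the chart), `P` a
homogeneous prime (the orbit closure), `x = (x₀, x₁)` generators of `P · A_P` (a regular system of parameters
of `O = A_P`) such that — AT THE GENERIC TORUS POINT `B = A[M]_𝔓` — `(ε_P ∘ x; w; ℓ)` is the lex-maximal admissible
weighted centre germ of `F · B` (Abramovich–Quek–Schober; in the application this is their separable base change
clause at `k(t₁, …, t_m)`).  Then every piece `A ∩ (x^α : w·α ≥ n)` of the contracted Rees filtration is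
HOMOGENEOUS.  Proof: the twist `θ_B` fixes `F · B`, so by UNIQUENESS (`LexMaxCentre.weightedMonomialIdeal_map_eq_of_ringEquiv`)
it fixes the filtration of `ε_P ∘ x`, i.e. `ρ_P` and `ε_P` extend each piece to the same ideal of `B`; conclude by
the kernel §3. [folklore] -/
theorem isHomogeneous_comap_weightedMonomialIdeal [UniqueSums M] (hP : Ideal.IsHomogeneous 𝒜 P)
    (F : Ideal A) (hF : F.IsHomogeneous 𝒜) (x : Fin 2 → O) (w : Fin 2 → ℕ) (ℓ : ℕ)
    (hx : Ideal.span (Set.range x) = P.map (algebraMap A O))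
    (hB : IsLexMaxWeightedCentreGerm B ((F.map (algebraMap A O)).map εP) (fun i => εP (x i)) w ℓ)
    (n : ℕ) : ((weightedMonomialIdeal x w n).comap (algebraMap A O)).IsHomogeneous 𝒜 := by
  obtain ⟨θB, hθε, hθF⟩ := exists_ringEquiv_comp_eq 𝒜 ρ hρ P O 𝔓 h𝔓 B εP ρP hε hρP hP
  have hfix := LexMaxCentre.weightedMonomialIdeal_map_eq_of_ringEquiv hB θB (hθF F hF) n
  rw [weightedMonomialIdeal_map] at hfix
  refine isHomogeneous_comap_of_map_le 𝒜 ρ hρ P O 𝔓 h𝔓 B εP ρP hε hρP _ ?_ (le_of_eq ?_)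
  · obtain ⟨-, hw, -⟩ := hB
    exact ⟨n, pow_le_weightedMonomialIdeal_of_span_eq x w hw hx n⟩
  · rw [weightedMonomialIdeal_map, weightedMonomialIdeal_map, ← hfix]
    congr 1
    funext i
    exact (RingHom.congr_fun hθε (x i)).symm

end Twist

end Summit.ResolutionOfSingularities.ResolutionOfSingularities.Theorems.OrbitCentreHomogeneous

end
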